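import Summits.AtomisticToContinuum.FouriersLaw.Theses.HonestZwanzig
import Summits.AtomisticToContinuum.FouriersLaw.Theorems.CoherentDephasing.Negative.LoadBearing

/-!
# `PositiveMemory` (crux stmt-AtomisticToContinuum-12694, route `HonestZwanzig`):
# the temperature sign `0 < T` is load-bearing — every slice `T ≤ 0` of the crux is FALSE
# (negative-side support, crux-disprover seat; from `Cruxes/PositiveMemory/Disproof.lean` §1)

`PositiveMemory` claims: for `pinnedChain ω₂ lam β γ` (all `> 0`) and `T > 0` there are `k₀ > 0` and `R` such that for
all `N ≥ 2`, every bulk bond `b` (`R ≤ b`, `b + 2 + R ≤ N`) and every limit `ρ = lim_{s↓0} schur_s(j_b, J)` one has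
`k₀ ≤ ρ` (objects: `μ = gibbsMeasure N T`, `corr`, `lap`, `G`, `schur` of the route file, verbatim below).

Here we record, sorry-free, what happens when the sign condition on `T` is relaxed:

* `slice_false_of_nonpos` — for EVERY parameter point and every `T ≤ 0` the `T`-slice of the conclusion fails: the
  Gibbs weight `e^{-H/T} ≥ 1` is not integrable on the infinite-volume phase space, so Mathlib's `Measure.tilted` makes
  `gibbsMeasure N T` the ZERO measure (`CoherentDephasing.Negative.LoadBearing.pinnedChain_gibbsMeasure_succ_eq_zero_of_nonpos`,
  reused), every `corr / lap / G / schur` in the statement vanishes identically, the limit `ρ_b = 0` EXISTS at the bulk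
  bond `b = R` of the chain `N = 2R + 2`, and `k₀ ≤ 0` contradicts `0 < k₀`.
* `positiveMemory_false_without_TPos` — hence the crux with `0 < T` weakened to `0 ≤ T` (stated inline; no proposition
  is defined under `Summits/`) is false.

Moral for provers: `0 < T` enters ONLY through normalisability of `e^{-H/T}` (it is what makes `μ` a probability measure
and `corr` an honest covariance); no estimate in a proof of `PositiveMemory` can be uniform down to `T = 0` in these
Lean objects, and the junk slice carries no physics (the physical `T ↓ 0` limit is the weakly anharmonic regime, where
`k(T) = T²κ(T)` is expected to stay of order one, cf. `Literature.Barriers.AtomisticToContinuum.LowTemperatureWeakAnharmonicity`).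
This file does NOT refute the crux.
-/

noncomputable section

namespace Summit.AtomisticToContinuum.FouriersLaw.Theorems.PositiveMemory.Negative.FalseWithoutTPos

open MeasureTheory Filter Topology Set
open Literature.MathematicalPhysics.KineticTheory.HeatConduction
open Summit.AtomisticToContinuum.FouriersLaw.Theorems.CoherentDephasing.Negative.LoadBearing

/-- **Every slice `T ≤ 0` of `PositiveMemory` is false.** For all `ω₂, lam, β ≥ 0`, all `γ`, all `T ≤ 0`: there are NO
`k₀ > 0`, `R` with the crux's conclusion, because at `N = 2R + 2`, `b = R` the function `s ↦ schur_s(j_b, J)` is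
identically `0` (zero Gibbs measure) and tends to `0 < k₀`. [folklore] -/
theorem slice_false_of_nonpos {ω₂ lam β : ℝ} (γ : ℝ) (hω : 0 ≤ ω₂) (hl : 0 ≤ lam) (hβ : 0 ≤ β) {T : ℝ} (hT : T ≤ 0) :
    ¬ ∃ k₀ : ℝ, 0 < k₀ ∧ ∃ R : ℕ, ∀ N : ℕ, 2 ≤ N → let P := Literature.MathematicalPhysics.KineticTheory.HeatConduction.pinnedChain ω₂ lam β γ; let X := Literature.MathematicalPhysics.KineticTheory.HeatConduction.PhaseSpace N; let μ : MeasureTheory.Measure X := P.gibbsMeasure N T; let corr : (X → ℝ) → (X → ℝ) → ℝ → ℝ := fun f g t => (∫ z, f z * (∫ y, g y ∂(P.transitionKernel N T T t.toNNReal z)) ∂μ) - (∫ z, f z ∂μ) * (∫ z, g z ∂μ); let lap : ℝ → (X → ℝ) → (X → ℝ) → ℝ := fun s f g => ∫ t in Set.Ioi (0 : ℝ), Real.exp (-(s * t)) * corr f g t; let e : Fin N → X → ℝ := fun x z => z.2 x ^ 2 / 2 + P.U (z.1 x) + ∑ j : Fin N, ((if j.val = x.val + 1 then P.V (z.1 j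 - z.1 x) / 2 else 0) + (if x.val = j.val + 1 then P.V (z.1 x - z.1 j) / 2 else 0)); let G : ℝ → Matrix (Fin N) (Fin N) ℝ := fun s => Matrix.of fun x y => lap s (e x) (e y); let schur : ℝ → (X → ℝ) → (X → ℝ) → ℝ := fun s f g => lap s f g - ∑ x : Fin N, ∑ y : Fin N, lap s f (e x) * (G s)⁻¹ x y * lap s (e y) g; let J : X → ℝ := fun z => ∑ i : Fin N, P.bondCurrent N i z; ∀ b : Fin N, R ≤ b.val → b.val + 2 + R ≤ N → ∀ ρ : ℝ, Filter.Tendsto (fun s => schur s (P.bondCurrent N b) J) (nhdsWithin (0 : ℝ) (Set.Ioi 0)) (nhds ρ) → k₀ ≤ ρ := by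
  rintro ⟨k₀, hk₀, R, hR⟩
  have hN : 2 ≤ 2 * R + 1 + 1 := by omega
  have key := hR (2 * R + 1 + 1) hN
  dsimp only at key
  have hb : R < 2 * R + 1 + 1 := by omega
  have hμ : (pinnedChain ω₂ lam β γ).gibbsMeasure (2 * R + 1 + 1) T = 0 :=
    pinnedChain_gibbsMeasure_succ_eq_zero_of_nonpos γ hω hl hβ (2 * R + 1) hT
  have h0 := key ⟨R, hb⟩ le_rfl (by simp only; omega) 0 ?_
  · linarith
  · rw [hμ]
    simp only [integral_zero_measure, mul_zero, sub_zero, integral_zero, zero_mul, Finset.sum_const_zero]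
    exact tendsto_const_nhds

/-- **`PositiveMemory` with `0 < T` weakened to `0 ≤ T` is false** (witness `T = 0` at any admissible parameter point,
e.g. `ω₂ = lam = β = γ = 1`). Any proof of the crux must use `0 < T`, and uses it exactly for normalisability. [folklore] -/
theorem positiveMemory_false_without_TPos :
    ¬ ∀ ω₂ lam β γ : ℝ, 0 < ω₂ → 0 < lam → 0 < β → 0 < γ → ∀ T : ℝ, 0 ≤ T → ∃ k₀ : ℝ, 0 < k₀ ∧ ∃ R : ℕ, ∀ N : ℕ, 2 ≤ N → let P := Literature.MathematicalPhysics.KineticTheory.HeatConduction.pinnedChain ω₂ lam β γ; let X := Literature.MathematicalPhysics.KineticTheory.HeatConduction.PhaseSpace N; let μ : MeasureTheory.Measure X := P.gibbsMeasure N T; let corr : (X → ℝ) → (X → ℝ) → ℝ → ℝ := fun f g t => (∫ z, f z * (∫ y, g y ∂(P.transitionKernel N T T t.toNNReal z)) ∂μ) - (∫ z, f z ∂μ) * (∫ z, g z ∂μ); let lap : ℝ → (X → ℝ) → (X → ℝ) → ℝ := fun s f g => ∫ t in Set.Ioi (0 : ℝ), Real.exp (-(s * t)) * corr f g t; let e :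 Fin N → X → ℝ := fun x z => z.2 x ^ 2 / 2 + P.U (z.1 x) + ∑ j : Fin N, ((if j.val = x.val + 1 then P.V (z.1 j - z.1 x) / 2 else 0) + (if x.val = j.val + 1 then P.V (z.1 x - z.1 j) / 2 else 0)); let G : ℝ → Matrix (Fin N) (Fin N) ℝ := fun s => Matrix.of fun x y => lap s (e x) (e y); let schur : ℝ → (X → ℝ) → (X → ℝ) → ℝ := fun s f g => lap s f g - ∑ x : Fin N, ∑ y : Fin N, lap s f (e x) * (G s)⁻¹ x y * lap s (e y) g; let J : X → ℝ := fun z => ∑ i : Fin N, P.bondCurrent N i z; ∀ b : Fin N, R ≤ b.val → b.val + 2 + R ≤ N → ∀ ρ : ℝ, Filter.Tendsto (fun s => schur s (P.bondCurrent N b) J) (nhdsWithin (0 : ℝ) (Set.Ioi 0)) (nhds ρ) → k₀ ≤ ρ := by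
  intro h
  exact slice_false_of_nonpos (ω₂ := 1) (lam := 1) (β := 1) 1 zero_le_one zero_le_one zero_le_one le_rfl
    (h 1 1 1 1 one_pos one_pos one_pos one_pos 0 le_rfl)

end Summit.AtomisticToContinuum.FouriersLaw.Theorems.PositiveMemory.Negative.FalseWithoutTPos

end
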